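import Summits.CriticalPhenomena.CardyFormulaZ2.Theorems.CardyComplexConeParafermionToSLESixFamiliesDiamondTurnCountFrame
import HarnessLib

/-!
# The escape staircase of a touch site: safe route vertices
# (line `potential-darboux-picard-diamond`, S1t `stub_freeSideTurnCount`, part 4)

Crux `ParafermionToSLESixFamilies` (stmt-CriticalPhenomena-11389), line `potential-darboux-picard-diamond`, stub
`stub_freeSideTurnCount` (S1t). The escape path of a touch site `u` is its prefix (dip, outward spur along the row
`upC = upC u - 1`, descent along the far column `xiC = K`) followed by a route back to the start edge; the splicing lemma
`splice_escapeData` (`…DiamondTurnCountSplice.lean`) asks every route vertex to be a `SafeVertex` for `u` (`…DiamondTurnCountFrame.lean`): an outside site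
off the spur row and the far column, or a diamond site outside the `2 × 2` block `{xiC u, xiC u + 1} × {upC u - 1, upC u}`.
The three routes (`…RouteBot`, `…RouteTop`, `…RouteEast`) are used
under three SEPARATION inequalities between the outer corner `p` of the start edge and `u` (in the coordinates
`xiC k`, `upC k` of the side): `xiC p + upC p ≤ xiC u + upC u - 8` (bottom route: `p` is before `u` along the side, or
beyond the previous side), `xiC p - upC p ≤ xiC u - upC u - 8` (top route: `p` is beyond the opposite side),
`upC u + 4 ≤ upC p` (east route: `p` is after `u` along the side, or beyond the next side). This file checks, by linear
arithmetic, that under the corresponding inequality every vertex class of the route — and the gadget vertices, the outside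
site `p` and diamond sites in its block — is safe: `safeVertex_of_bot`, `safeVertex_of_top`, `safeVertex_of_east`
(registered: `safeVertex_of_east`).
-/

noncomputable section

namespace Summit.CriticalPhenomena.CardyFormulaZ2.Cruxes.ParafermionToSLESixFamilies.PotentialDarbouxPicardDiamond

open Literature.Probability Literature.Probability.LatticeModels

variable {k : Fin 4} {K : ℤ} {K₀ : ℕ} {ι : Site 2 → ℤ} {u p v : Site 2}

/-- **Bottom route vertices are safe** under `xiC p + upC p ≤ xiC u + upC u - 8`. -/
theorem safeVertex_of_bot (hK : K = 3 * K₀ + 10) (hu2 : |upC k u| ≤ K₀) (hp1 : |xiC k p| ≤ K₀ + 1)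
    (hS : xiC k p + upC k p ≤ xiC k u + upC k u - 8)
    (hv : ((upC k v = -K ∧ xiC k p + 1 ≤ xiC k v ∧ xiC k v ≤ K ∧ ι v = 0) ∨
        (xiC k v = xiC k p ∧ -K ≤ upC k v ∧ upC k v ≤ upC k p - 1 ∧ ι v = 0)) ∨
      (xiC k v = xiC k p ∧ upC k v = upC k p ∧ ι v = 0) ∨ (ι v = 1 ∧ |xiC k v - xiC k p| ≤ 1 ∧ |upC k v - upC k p| ≤ 1)) :
    SafeVertex k u K ι v := by
  rw [abs_le] at hu2 hp1
  unfold SafeVertex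
  rcases hv with (⟨h1, h2, h3, h4⟩ | ⟨h1, h2, h3, h4⟩) | ⟨h1, h2, h3⟩ | ⟨h1, h2, h3⟩
  · left; exact ⟨h4, by omega, by omega⟩
  · left; exact ⟨h4, by omega, by omega⟩
  · left; exact ⟨h3, by omega, by omega⟩
  · rw [abs_le] at h2 h3
    right; exact ⟨h1, by omega⟩

/-- **Top route vertices are safe** under `xiC p - upC p ≤ xiC u - upC u - 8`. -/
theorem safeVertex_of_top (hK : K = 3 * K₀ + 10) (hu2 : |upC k u| ≤ K₀) (hp1 : |xiC k p| ≤ K₀ + 1)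
    (hp2 : |upC k p| ≤ K₀ + 1) (hS : xiC k p - upC k p ≤ xiC k u - upC k u - 8)
    (hv : ((upC k v = -K ∧ -K + 1 ≤ xiC k v ∧ xiC k v ≤ K ∧ ι v = 0) ∨ (xiC k v = -K ∧ -K ≤ upC k v ∧ upC k v ≤ K - 1 ∧ ι v = 0) ∨
        (upC k v = K ∧ -K ≤ xiC k v ∧ xiC k v ≤ xiC k p - 1 ∧ ι v = 0) ∨
        (xiC k v = xiC k p ∧ upC k p + 1 ≤ upC k v ∧ upC k v ≤ K ∧ ι v = 0)) ∨
      (xiC k v = xiC k p ∧ upC k v = upC k p ∧ ι v = 0) ∨ (ι v = 1 ∧ |xiC k v - xiC k p| ≤ 1 ∧ |upC k v - upC k p| ≤ 1)) :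
    SafeVertex k u K ι v := by
  rw [abs_le] at hu2 hp1 hp2
  unfold SafeVertex
  rcases hv with (⟨h1, h2, h3, h4⟩ | ⟨h1, h2, h3, h4⟩ | ⟨h1, h2, h3, h4⟩ | ⟨h1, h2, h3, h4⟩) | ⟨h1, h2, h3⟩ | ⟨h1, h2, h3⟩
  · left; exact ⟨h4, by omega, by omega⟩
  · left; exact ⟨h4, by omega, by omega⟩
  · left; exact ⟨h4, by omega, by omega⟩
  · left; exact ⟨h4, by omega, by omega⟩
  · left; exact ⟨h3, by omega, by omega⟩
  · rw [abs_le] at h2 h3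
    right; exact ⟨h1, by omega⟩

/-- **East route vertices are safe** under `upC u + 4 ≤ upC p` (registered helper of `stub_freeSideTurnCount`). -/
theorem safeVertex_of_east : ∀ (k : Fin 4) (K : ℤ) (K₀ : ℕ) (ι : Site 2 → ℤ) (u p v : Site 2), K = 3 * K₀ + 10 → |xiC k u| ≤ K₀ → |upC k u| ≤ K₀ → |xiC k p| ≤ K₀ + 1 → |upC k p| ≤ K₀ + 1 → upC k u + 4 ≤ upC k p → (((upC k v = -K ∧ -K + 1 ≤ xiC k v ∧ xiC k v ≤ K ∧ ι v = 0) ∨ (xiC k v = -K ∧ -K ≤ upC k v ∧ upC k v ≤ K - 1 ∧ ι v = 0) ∨ (upC k v = K ∧ -K ≤ xiC k v ∧ xiC k v ≤ K - 1 ∧ ι v = 0) ∨ (xiC k v = K ∧ upC k p + 1 ≤ upC k v ∧ upC k v ≤ K ∧ ι v = 0) ∨ (upC k v = upC k p ∧ xiC k p + 1 ≤ xiC k v ∧ xiC k v ≤ K ∧ ι v = 0)) ∨ (xiC k v = xiC k p ∧ upC k v = upC k p ∧ ι v = 0) ∨ (ι v = 1 ∧ |xiC k v - xiC k p| ≤ 1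 ∧ |upC k v - upC k p| ≤ 1)) → SafeVertex k u K ι v := by
  intro k K K₀ ι u p v hK hu1 hu2 hp1 hp2 hS hv
  rw [abs_le] at hu1 hu2 hp1 hp2
  unfold SafeVertex
  rcases hv with (⟨h1, h2, h3, h4⟩ | ⟨h1, h2, h3, h4⟩ | ⟨h1, h2, h3, h4⟩ | ⟨h1, h2, h3, h4⟩ | ⟨h1, h2, h3, h4⟩) | ⟨h1, h2, h3⟩ |
    ⟨h1, h2, h3⟩
  · left; exact ⟨h4, by omega, by omega⟩
  · left; exact ⟨h4, by omega, by omega⟩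
  · left; exact ⟨h4, by omega, by omega⟩
  · left; exact ⟨h4, by omega, by omega⟩
  · left; exact ⟨h4, by omega, by omega⟩
  · left; exact ⟨h3, by omega, by omega⟩
  · rw [abs_le] at h2 h3
    right; exact ⟨h1, by omega⟩

end Summit.CriticalPhenomena.CardyFormulaZ2.Cruxes.ParafermionToSLESixFamilies.PotentialDarbouxPicardDiamond

end
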